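import Summits.Langlands.Langlands.Statement
import HarnessLib

/-!
# On-path lemma (F4) for the rung `OddRegularGaloisToAutomorphicQ 3` of line
# `OddRegularGaloisToAutomorphicQ3` (crux `ReciprocityUpToIrreducibility`, item stmt-Langlands-14328)

`Langlands → OddRegularGaloisToAutomorphicQ n` for every `0 < n` (in particular the rung `n = 3` and
every higher rung): clause (B) of the summit over `ℚ` at any reciprocity datum — one exists by the
`Nonempty` conjunct of the Statement — applies to every `ρ` on the sector, because the sector's
de Rham clause is stated against the PINNED Fontaine datum `fontainePstAdicCompletion v ℓ hv`, which is
`Rec.pst ℓ v hv` by definition (`ReciprocityData.pst`), so the sector hypotheses give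
`IsGeometricFramed Rec ρ`; `Corresponds Rec ι π ρ` contains a.e. Satake–Frobenius matching as its
first conjunct.  The family is VERBATIM the one of `Lines/OddRegularGaloisToAutomorphicQ3.lean`.
Sorry-free; standard axioms.
-/

noncomputable section

set_option linter.dupNamespace false

open scoped MatrixGroups Matrix NumberField Classical Polynomial
open Filter IsDedekindDomain Field Polynomial
open Literature.NumberTheory.Automorphic Literature.NumberTheory.GaloisRepresentations
open Literature.NumberTheory.PAdicHodge
open Summit.Langlands

namespace Summit.Langlands.Langlands.Cruxes.ReciprocityUpToIrreducibility.OddRegularGaloisToAutomorphicQ3.OnPath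

/-- **The rung family** (dial = rank `n`): clause (B) over `ℚ` on the Fontaine–Mazur sector at odd `ℓ`,
Caraiani–Le Hung parity, a.e.-Satake conclusion.  At `n = 2` it is (equivalent to, `floor_two`) the
tree item `DyadicOddResidue.OddPrimesRegularFM`. -/
def OddRegularGaloisToAutomorphicQ (n : ℕ) : Prop :=
  ∀ (ℓ : ℕ) [Fact ℓ.Prime], ℓ ≠ 2 →
    ∀ (ρ : Literature.NumberTheory.GaloisRepresentations.FramedGaloisRep ℚ (PadicAlgCl ℓ) n),
      ρ.toGaloisRep.IsIrreducible →
      (∀ (φ : ℚ →+* ℝ) (c : Field.absoluteGaloisGroup ℚ),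
        Literature.NumberTheory.GaloisRepresentations.IsComplexConjugation φ c →
          (ρ c).val.trace = 0 ∨ (ρ c).val.trace = 1 ∨ (ρ c).val.trace = -1) →
      (∀ᶠ v : IsDedekindDomain.HeightOneSpectrum (NumberField.RingOfIntegers ℚ) in Filter.cofinite,
        ρ.IsUnramifiedAt v) →
      (∀ (v : IsDedekindDomain.HeightOneSpectrum (NumberField.RingOfIntegers ℚ))
        (hv : ((ℓ : ℕ) : NumberField.RingOfIntegers ℚ) ∈ v.asIdeal),
        (Literature.NumberTheory.PAdicHodge.fontainePstAdicCompletion v ℓ hv).IsDeRhamFramed (ρ.toLocal v) ∧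
        ∀ τ : v.adicCompletion ℚ →+* PadicAlgCl ℓ, Continuous τ →
          (ρ.labelledHodgeTateWeightsAt v
            (Literature.NumberTheory.PAdicHodge.fontainePstAdicCompletion v ℓ hv).algebra
            (Literature.NumberTheory.PAdicHodge.fontainePstAdicCompletion v ℓ hv).𝔅 τ).Nodup) →
      ∀ (hcpt : Literature.NumberTheory.Automorphic.isCompact_glFiniteIntegralLevel n ℚ)
        (ι : PadicAlgCl ℓ ≃+* ℂ),
        ∃ π : Literature.NumberTheory.Automorphic.CuspidalAutomorphicRepData n ℚ hcpt,
          π.1.IsLAlgebraic ∧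
          ∀ᶠ v : IsDedekindDomain.HeightOneSpectrum (NumberField.RingOfIntegers ℚ) in Filter.cofinite,
            Summit.Langlands.SatakeFrobCompatibleAt ι π.1 ρ v

/-- **THE RUNG** (the filed statement): the family at `n = 3`. -/
def OddRegularGaloisToAutomorphicQ3 : Prop := OddRegularGaloisToAutomorphicQ 3

/-- **Dial monotonicity in the summit direction**: the summit gives every rung of the family. -/
theorem oddRegularGaloisToAutomorphicQ_of_langlands {n : ℕ} (hn : 0 < n) (hL : _root_.Langlands) :
    OddRegularGaloisToAutomorphicQ n := by
  intro ℓ _ _hℓ ρ hirr _hsign hunr hdR hcpt ι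
  obtain ⟨⟨Rec⟩, hall⟩ := hL ℚ
  have hB : GaloisToAutomorphic n Rec hcpt := (hall Rec n hn hcpt).2
  have hgeo : IsGeometricFramed Rec ρ := ⟨hunr, fun v hv => (hdR v hv).1⟩
  obtain ⟨π, hLalg, hcorr⟩ := hB ℓ ι ρ hirr hgeo
  exact ⟨π, hLalg, hcorr.1⟩

/-- **F4 on-path lemma for the rung**: `Langlands → OddRegularGaloisToAutomorphicQ 3`. -/
@[aesop safe apply]
theorem OddRegularGaloisToAutomorphicQ3_of_Langlands (hL : _root_.Langlands) :
    OddRegularGaloisToAutomorphicQ3 :=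
  oddRegularGaloisToAutomorphicQ_of_langlands (by norm_num) hL

end Summit.Langlands.Langlands.Cruxes.ReciprocityUpToIrreducibility.OddRegularGaloisToAutomorphicQ3.OnPath

end
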